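import Mathlib
import Literature.Barriers.ValiantsHypothesis.ShiftedPartialsCaseC3
import Summits.AtomisticToContinuum.HydrodynamicLimit.Theorems.ImplosionDichotomyDenseExcursionSonicCentreContentInnerPointIneq
import Summits.AtomisticToContinuum.HydrodynamicLimit.Theorems.ImplosionDichotomyDenseExcursionSonicCentreContentInnerBarrier

/-!
# The centre standing wave, part 1: the deep region from `x → −∞` to `x₁ = log(1/‖Λ‖)`
# (crux `DenseExcursion`, line `sonic-cavity-renewal`, brick for `centreContent_of_tube`)

Helper file (`--supports stmt-AtomisticToContinuum-12586`, line lead a2, stub-worker W3 for `centreContent_of_tube`).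

For a smooth radial mode the centre variables have limits `eˣŵ → 0`, `eˣŝ → σ` (`regularPair_centre_limits`), so the
travelling-wave pair `(v, z)` tends to `(σ, 0)` and all four energies `N`, `E`, `‖v ∓ z‖²` tend to `E∞ = ‖σ‖²`. Integrating the
differential inequalities of `inner_pointI` from `−∞` with the barrier lemmas (explicit majorants `a eˣ + b e^{2x}`) gives at
`x₁ = log(1/‖Λ‖)` (`ρ₁ ≤ 1/1000`): `E(x₁) ≤ 1.03E∞`, `‖v − z‖²(x₁) ≤ 1.02E∞`, `‖v + z‖²(x₁) ≥ 0.985E∞` (`centre_inner_regionI`,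
registered helper). NOT here: region II and the conclusion at `x₀ = log(1/100)` (part 2).
-/

noncomputable section

open Filter Set
open scoped Topology

namespace Summit.AtomisticToContinuum.HydrodynamicLimit.Theorems.SonicCavityRenewal

open Summit.AtomisticToContinuum.HydrodynamicLimit.Theorems.R2OneModeTwoConditions
open Literature.Barriers.ValiantsHypothesis (exp_le_quadratic)

/-- `exp t ≤ 1 + c + c²` for `0 ≤ t ≤ c ≤ 1`. [folklore] -/
theorem exp_small_le {t c : ℝ} (h0 : 0 ≤ t) (htc : t ≤ c) (hc1 : c ≤ 1) : Real.exp t ≤ 1 + c + c ^ 2 := by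
  refine (exp_le_quadratic h0 (htc.trans hc1)).trans ?_
  nlinarith [mul_le_mul htc htc h0 (h0.trans htc)]

set_option maxHeartbeats 800000 in
/-- NUMERICS OF REGION I: with `ρ₁ ≤ 1/1000` the four barrier outputs at `x₁` give `Ē ≤ 1.03E∞`, `E₋(x₁) ≤ 1.02E∞`,
`E₊(x₁) ≥ 0.985E∞`. [folklore] -/
theorem regionI_numerics (ρ₁ Einf Nb Eb M P : ℝ) (hρ₁0 : 0 < ρ₁) (hρ₁ : ρ₁ ≤ 1 / 1000) (hE0 : 0 ≤ Einf)
    (hNb : Nb = Real.exp (1122 / 100 * ρ₁ + 21 / 2 * ρ₁ ^ 2) * Einf)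
    (hEb : Eb = Real.exp (1236 / 100 * ρ₁ + 445 / 20 * ρ₁ ^ 2) * (Einf + (63 / 10 * ρ₁ + 115 / 20 * ρ₁ ^ 2) * Nb))
    (hM : M ≤ Real.exp (702 / 100 * ρ₁ + 335 / 20 * ρ₁ ^ 2) *
      (Einf + (11 * ρ₁ ^ 2 * Eb + (63 / 10 * ρ₁ + 115 / 20 * ρ₁ ^ 2) * Nb)))
    (hP : Real.exp (-(702 / 100 * ρ₁ + 2342 / 200 * ρ₁ ^ 2)) * (Einf - Real.exp (702 / 100 * ρ₁ + 2342 / 200 * ρ₁ ^ 2) *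
      (11 * ρ₁ ^ 2 * Eb + (63 / 10 * ρ₁ + 115 / 20 * ρ₁ ^ 2) * Nb)) ≤ P) :
    Eb ≤ 103 / 100 * Einf ∧ M ≤ 102 / 100 * Einf ∧ 985 / 1000 * Einf ≤ P := by
  have hq : ρ₁ ^ 2 ≤ 1 / 1000 * ρ₁ := by
    have h := mul_le_mul_of_nonneg_left hρ₁ hρ₁0.le
    calc ρ₁ ^ 2 = ρ₁ * ρ₁ := sq ρ₁
      _ ≤ ρ₁ * (1 / 1000) := h
      _ = 1 / 1000 * ρ₁ := by ring
  have hNb0 : 0 ≤ Nb := by rw [hNb]; positivity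
  have hEb0 : 0 ≤ Eb := by rw [hEb]; positivity
  -- N̄ ≤ 1.0115 E∞
  have t1 : 1122 / 100 * ρ₁ + 21 / 2 * ρ₁ ^ 2 ≤ 113 / 10000 := by linarith [hq, hρ₁]
  have t1' : 0 ≤ 1122 / 100 * ρ₁ + 21 / 2 * ρ₁ ^ 2 := by positivity
  have e1 : Real.exp (1122 / 100 * ρ₁ + 21 / 2 * ρ₁ ^ 2) ≤ 10115 / 10000 := by
    refine (exp_small_le t1' t1 (by norm_num)).trans ?_
    norm_num
  have hNb1 : Nb ≤ 10115 / 10000 * Einf := by rw [hNb]; exact mul_le_mul_of_nonneg_right e1 hE0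
  -- Ē ≤ 1.03 E∞
  have t2 : 1236 / 100 * ρ₁ + 445 / 20 * ρ₁ ^ 2 ≤ 124 / 10000 := by linarith [hq, hρ₁]
  have t2' : 0 ≤ 1236 / 100 * ρ₁ + 445 / 20 * ρ₁ ^ 2 := by positivity
  have e2 : Real.exp (1236 / 100 * ρ₁ + 445 / 20 * ρ₁ ^ 2) ≤ 10126 / 10000 := by
    refine (exp_small_le t2' t2 (by norm_num)).trans ?_
    norm_num
  have t3 : 63 / 10 * ρ₁ + 115 / 20 * ρ₁ ^ 2 ≤ 64 / 10000 := by linarith [hq, hρ₁]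
  have s3 : (63 / 10 * ρ₁ + 115 / 20 * ρ₁ ^ 2) * Nb ≤ 64 / 10000 * (10115 / 10000 * Einf) :=
    mul_le_mul t3 hNb1 hNb0 (by norm_num)
  have hEb1 : Eb ≤ 103 / 100 * Einf := by
    have h1 : Einf + (63 / 10 * ρ₁ + 115 / 20 * ρ₁ ^ 2) * Nb ≤ (1 + 64 / 10000 * (10115 / 10000)) * Einf := by linarith
    rw [hEb]
    calc _ ≤ 10126 / 10000 * ((1 + 64 / 10000 * (10115 / 10000)) * Einf) :=
          mul_le_mul e2 h1 (by positivity) (by norm_num)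
      _ ≤ 103 / 100 * Einf := by linarith [hE0]
  -- the common source term at x₁
  have t4 : 11 * ρ₁ ^ 2 * Eb ≤ 11 * (1 / 1000 * (1 / 1000)) * (103 / 100 * Einf) := by
    have : ρ₁ ^ 2 ≤ 1 / 1000 * (1 / 1000) := by linarith [hq, hρ₁]
    exact mul_le_mul (mul_le_mul_of_nonneg_left this (by norm_num)) hEb1 hEb0 (by positivity)
  have hsrc : 11 * ρ₁ ^ 2 * Eb + (63 / 10 * ρ₁ + 115 / 20 * ρ₁ ^ 2) * Nb ≤ 65 / 10000 * Einf := by linarith [t4, s3, hE0]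
  have hsrc0 : 0 ≤ 11 * ρ₁ ^ 2 * Eb + (63 / 10 * ρ₁ + 115 / 20 * ρ₁ ^ 2) * Nb := by positivity
  -- E₋
  have t5 : 702 / 100 * ρ₁ + 335 / 20 * ρ₁ ^ 2 ≤ 704 / 100000 := by linarith [hq, hρ₁]
  have t5' : 0 ≤ 702 / 100 * ρ₁ + 335 / 20 * ρ₁ ^ 2 := by positivity
  have e5 : Real.exp (702 / 100 * ρ₁ + 335 / 20 * ρ₁ ^ 2) ≤ 10071 / 10000 := by
    refine (exp_small_le t5' t5 (by norm_num)).trans ?_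
    norm_num
  have hEm1 : M ≤ 102 / 100 * Einf := by
    refine hM.trans ?_
    calc _ ≤ 10071 / 10000 * (Einf + 65 / 10000 * Einf) := mul_le_mul e5 (by linarith) (by positivity) (by norm_num)
      _ ≤ 102 / 100 * Einf := by linarith [hE0]
  -- E₊
  have t6 : 702 / 100 * ρ₁ + 2342 / 200 * ρ₁ ^ 2 ≤ 704 / 100000 := by linarith [hq, hρ₁]
  have t6' : 0 ≤ 702 / 100 * ρ₁ + 2342 / 200 * ρ₁ ^ 2 := by positivity
  have e6 : Real.exp (702 / 100 * ρ₁ + 2342 / 200 * ρ₁ ^ 2) ≤ 10071 / 10000 := by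
    refine (exp_small_le t6' t6 (by norm_num)).trans ?_
    norm_num
  have e6' : 1 - 704 / 100000 ≤ Real.exp (-(702 / 100 * ρ₁ + 2342 / 200 * ρ₁ ^ 2)) := by
    have := Real.add_one_le_exp (-(702 / 100 * ρ₁ + 2342 / 200 * ρ₁ ^ 2))
    linarith
  have hEp1 : 985 / 1000 * Einf ≤ P := by
    refine le_trans ?_ hP
    have h1 : Real.exp (702 / 100 * ρ₁ + 2342 / 200 * ρ₁ ^ 2) * (11 * ρ₁ ^ 2 * Eb + (63 / 10 * ρ₁ + 115 / 20 * ρ₁ ^ 2) * Nb) ≤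
        10071 / 10000 * (65 / 10000 * Einf) := mul_le_mul e6 hsrc hsrc0 (by norm_num)
    have h2 : (1 - 704 / 100000) * (Einf - 10071 / 10000 * (65 / 10000 * Einf)) ≤
        Real.exp (-(702 / 100 * ρ₁ + 2342 / 200 * ρ₁ ^ 2)) *
          (Einf - Real.exp (702 / 100 * ρ₁ + 2342 / 200 * ρ₁ ^ 2) *
            (11 * ρ₁ ^ 2 * Eb + (63 / 10 * ρ₁ + 115 / 20 * ρ₁ ^ 2) * Nb)) :=
      mul_le_mul e6' (by linarith) (by linarith [hE0]) (Real.exp_pos _).le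
    linarith [hE0]
  exact ⟨hEb1, hEm1, hEp1⟩

set_option maxHeartbeats 1600000 in
/-- **Registered helper `centre_inner_regionI`: THE DEEP REGION `eˣ ≤ 1/‖Λ‖` FROM THE CENTRE.** For a smooth radial mode of
a tube profile (pinned window, `−1/4 < Re Λ ≤ 3`, `‖Λ‖ ≥ 1000`) there is `E∞ ≥ 0` (the common limit `‖σ‖²` of all the energies
at `x → −∞`, `σ = lim eˣŝ`, from `regularPair_centre_limits`) with, at `x₁ = log(1/‖Λ‖)`: total energy `E(x₁) ≤ 1.03E∞`,
regular family `‖v − z‖²(x₁) ≤ 1.02E∞`, degenerate family `‖v + z‖²(x₁) ≥ 0.985E∞` — the two acoustic families leave the centre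
with equal amplitude (standing wave). Proof: barriers from `−∞` (`barrier_upper_atBot`/`barrier_lower_atBot`) for `N`
(a priori), `E`, `‖v−z‖²`, `‖v+z‖²` with the inequalities of `inner_pointI`; all error integrals are `O(1/‖Λ‖)`. [folklore] -/
theorem centre_inner_regionI : ∀ {r : ℝ} {W S : ℝ → ℝ} {Λ : ℂ} {ŵ ŝ : ℝ → ℂ}, 17307 / 15625 ≤ r → r ≤ 89409 / 80000 → IsMonatomicProfile r W S → CavityTube r W S → IsSmoothRadialMode r W S Λ ŵ ŝ → -(1 / 4 : ℝ) < Λ.re → Λ.re ≤ 3 → 1000 ≤ ‖Λ‖ → ∃ Einf : ℝ, 0 ≤ Einf ∧ (fun t => ‖(((Real.exp t : ℂ) * ŝ t) + (Λ * ((-S t / ((W t - 1) ^ 2 - S t ^ 2) : ℝ) : ℂ) / 3) * ((Real.exp t : ℂ) * ŵ t))‖ ^ 2 + ‖(Λ * ((-S t / ((W t - 1) ^ 2 - S t ^ 2) : ℝ) : ℂ) * ((Real.exp t : ℂ) * ŝ t))‖ ^ 2) (Real.log (1 / ‖Λ‖)) ≤ 103 / 100 * Einf ∧ (fun t => ‖(((Real.exp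 t : ℂ) * ŝ t) + (Λ * ((-S t / ((W t - 1) ^ 2 - S t ^ 2) : ℝ) : ℂ) / 3) * ((Real.exp t : ℂ) * ŵ t)) - (Λ * ((-S t / ((W t - 1) ^ 2 - S t ^ 2) : ℝ) : ℂ) * ((Real.exp t : ℂ) * ŝ t))‖ ^ 2) (Real.log (1 / ‖Λ‖)) ≤ 102 / 100 * Einf ∧ 985 / 1000 * Einf ≤ (fun t => ‖(((Real.exp t : ℂ) * ŝ t) + (Λ * ((-S t / ((W t - 1) ^ 2 - S t ^ 2) : ℝ) : ℂ) / 3) * ((Real.exp t : ℂ) * ŵ t)) + (Λ * ((-S t / ((W t - 1) ^ 2 - S t ^ 2) : ℝ) : ℂ) * ((Real.exp t : ℂ) * ŝ t))‖ ^ 2) (Real.log (1 / ‖Λ‖)) := by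
  intro r W S Λ ŵ ŝ hr₁ hr₂ hP hT hm hre₁ hre₂ hL
  obtain ⟨hreg, -, hmodes⟩ := hm
  have hŵd : Differentiable ℝ ŵ := hreg.1.differentiable (by simp)
  have hŝd : Differentiable ℝ ŝ := hreg.2.1.differentiable (by simp)
  have hL0 : 0 < ‖Λ‖ := by linarith
  have hx₁ : Real.exp (Real.log (1 / ‖Λ‖)) = 1 / ‖Λ‖ := Real.exp_log (by positivity)
  -- the point inequalities on region I
  have hyI : ∀ y, y ≤ (Real.log (1 / ‖Λ‖)) → Real.exp y ≤ 1 / 50 ∧ Real.exp y * ‖Λ‖ ≤ 1 := by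
    intro y hy
    have h1 : Real.exp y ≤ 1 / ‖Λ‖ := hx₁ ▸ Real.exp_le_exp.2 hy
    have h2 : Real.exp y * ‖Λ‖ ≤ 1 := by
      have := mul_le_mul_of_nonneg_right h1 hL0.le
      rwa [one_div, inv_mul_cancel₀ hL0.ne'] at this
    exact ⟨h1.trans (one_div_le_one_div_of_le (by norm_num) (by linarith)), h2⟩
  have hptI := fun (y : ℝ) (hy : y ≤ (Real.log (1 / ‖Λ‖))) {Nb : ℝ} (hNb : (fun t => ‖((Real.exp t : ℂ) * ŵ t)‖ ^ 2 / 9 + ‖((Real.exp t : ℂ) * ŝ t)‖ ^ 2) y ≤ Nb) =>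
    inner_pointI hr₁ hr₂ hP hT hre₁ hre₂ hL (hyI y hy).1 (hŵd y) (hŝd y) (hmodes y) (hyI y hy).2 hNb
  -- limits at the centre
  obtain ⟨σ, hUlim, hSlim⟩ := regularPair_centre_limits ŵ ŝ hreg
  have hκlim : Tendsto (fun x => Λ * ((-S x / ((W x - 1) ^ 2 - S x ^ 2) : ℝ) : ℂ)) atBot (𝓝 0) := by
    have hb : ∀ᶠ x in atBot, ‖Λ * ((-S x / ((W x - 1) ^ 2 - S x ^ 2) : ℝ) : ℂ)‖ ≤ 144 / 100 * Real.exp x * ‖Λ‖ := by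
      filter_upwards [eventually_le_atBot (Real.log (1 / 50))] with x hx
      have hx' : Real.exp x ≤ 1 / 50 := by
        have := Real.exp_le_exp.2 hx
        rwa [Real.exp_log (by norm_num)] at this
      obtain ⟨-, -, -, -, -, -, -, -, -, -, -, -, -, -, -, -, -, -, ht₂, -⟩ :=
        inner_point hr₁ hr₂ hP hT hre₁ hre₂ hx' (hŵd x) (hŝd x) (hmodes x)
      exact ht₂
    refine squeeze_zero_norm' hb ?_
    have h := (Real.tendsto_exp_atBot.const_mul (144 / 100)).mul_const ‖Λ‖
    simpa using h
  have hVlim : Tendsto (fun x => (((Real.exp x : ℂ) * ŝ x) + (Λ * ((-S x / ((W x - 1) ^ 2 - S x ^ 2) : ℝ) : ℂ) / 3) * ((Real.exp x : ℂ) * ŵ x))) atBot (𝓝 σ) := by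
    have h := hSlim.add ((hκlim.div_const 3).mul hUlim)
    simpa using h
  have hZlim : Tendsto (fun x => (Λ * ((-S x / ((W x - 1) ^ 2 - S x ^ 2) : ℝ) : ℂ) * ((Real.exp x : ℂ) * ŝ x))) atBot (𝓝 0) := by
    have h := hκlim.mul hSlim
    simpa using h
  set Einf := ‖σ‖ ^ 2 with hEinf
  have hElim : Tendsto (fun t => ‖(((Real.exp t : ℂ) * ŝ t) + (Λ * ((-S t / ((W t - 1) ^ 2 - S t ^ 2) : ℝ) : ℂ) / 3) * ((Real.exp t : ℂ) * ŵ t))‖ ^ 2 + ‖(Λ * ((-S t / ((W t - 1) ^ 2 - S t ^ 2) : ℝ) : ℂ) * ((Real.exp t : ℂ) * ŝ t))‖ ^ 2) atBot (𝓝 Einf) := by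
    have h := ((hVlim.norm).pow 2).add ((hZlim.norm).pow 2)
    simpa [hEinf] using h
  have hEplim : Tendsto (fun t => ‖(((Real.exp t : ℂ) * ŝ t) + (Λ * ((-S t / ((W t - 1) ^ 2 - S t ^ 2) : ℝ) : ℂ) / 3) * ((Real.exp t : ℂ) * ŵ t)) + (Λ * ((-S t / ((W t - 1) ^ 2 - S t ^ 2) : ℝ) : ℂ) * ((Real.exp t : ℂ) * ŝ t))‖ ^ 2) atBot (𝓝 Einf) := by
    have h := ((hVlim.add hZlim).norm).pow 2
    simpa [hEinf] using h
  have hEmlim : Tendsto (fun t => ‖(((Real.exp t : ℂ) * ŝ t) + (Λ * ((-S t / ((W t - 1) ^ 2 - S t ^ 2) : ℝ) : ℂ) / 3) * ((Real.exp t : ℂ) * ŵ t)) - (Λ * ((-S t / ((W t - 1) ^ 2 - S t ^ 2) : ℝ) : ℂ) * ((Real.exp t : ℂ) * ŝ t))‖ ^ 2) atBot (𝓝 Einf) := by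
    have h := ((hVlim.sub hZlim).norm).pow 2
    simpa [hEinf] using h
  have hNlim : Tendsto (fun t => ‖((Real.exp t : ℂ) * ŵ t)‖ ^ 2 / 9 + ‖((Real.exp t : ℂ) * ŝ t)‖ ^ 2) atBot (𝓝 Einf) := by
    have h := (((hUlim.norm).pow 2).div_const 9).add ((hSlim.norm).pow 2)
    simpa [hEinf] using h
  -- calculus of the explicit majorants
  have hexp2 : ∀ y : ℝ, HasDerivAt (fun y => Real.exp y ^ 2) (2 * Real.exp y * Real.exp y) y := by
    intro y
    have h := (Real.hasDerivAt_exp y).fun_pow 2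
    refine h.congr_deriv ?_
    norm_num
  have hmaj : ∀ (a b c : ℝ), c = 2 * b → ∀ y : ℝ, HasDerivAt (fun y => a * Real.exp y + b * Real.exp y ^ 2)
      (a * Real.exp y + c * Real.exp y ^ 2) y := by
    intro a b c hc y
    have h := ((Real.hasDerivAt_exp y).const_mul a).add ((hexp2 y).const_mul b)
    refine h.congr_deriv ?_
    rw [hc]; ring
  have hmaj0 : ∀ (a b : ℝ), 0 ≤ a → 0 ≤ b → ∀ y : ℝ, 0 ≤ a * Real.exp y + b * Real.exp y ^ 2 := by
    intro a b ha hb y; positivity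
  have hmajlim : ∀ (a b : ℝ), Tendsto (fun y => a * Real.exp y + b * Real.exp y ^ 2) atBot (𝓝 0) := by
    intro a b
    have h := (Real.tendsto_exp_atBot.const_mul a).add ((Real.tendsto_exp_atBot.pow 2).const_mul b)
    simpa using h
  have hmajmono : ∀ (a b : ℝ), 0 ≤ a → 0 ≤ b → ∀ y y' : ℝ, y ≤ y' →
      a * Real.exp y + b * Real.exp y ^ 2 ≤ a * Real.exp y' + b * Real.exp y' ^ 2 := by
    intro a b ha hb y y' hyy
    have h1 : Real.exp y ≤ Real.exp y' := Real.exp_le_exp.2 hyy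
    have h2 : Real.exp y ^ 2 ≤ Real.exp y' ^ 2 := pow_le_pow_left₀ (Real.exp_pos y).le h1 2
    nlinarith
  have hρ₁ : Real.exp (Real.log (1 / ‖Λ‖)) ≤ 1 / 1000 := by rw [hx₁]; exact one_div_le_one_div_of_le (by norm_num) hL
  have hρ₁0 : 0 < Real.exp (Real.log (1 / ‖Λ‖)) := Real.exp_pos _
  have hE0 : 0 ≤ Einf := by positivity
  -- (N) a priori bound from −∞
  have hN : ∀ y ≤ (Real.log (1 / ‖Λ‖)), (fun t => ‖((Real.exp t : ℂ) * ŵ t)‖ ^ 2 / 9 + ‖((Real.exp t : ℂ) * ŝ t)‖ ^ 2) y ≤ Real.exp (1122 / 100 * Real.exp y + 21 / 2 * Real.exp y ^ 2) * (Einf + (fun _ => (0:ℝ)) y) := by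
    refine barrier_upper_atBot (f' := deriv (fun t => ‖((Real.exp t : ℂ) * ŵ t)‖ ^ 2 / 9 + ‖((Real.exp t : ℂ) * ŝ t)‖ ^ 2)) (𝔞' := (fun y => (1122 / 100 * Real.exp y + 21 * Real.exp y ^ 2))) (𝔟' := fun _ => 0)
      (fun y hy => (hptI y hy le_rfl).1.hasDerivAt) (fun y _ => hmaj _ _ _ (by norm_num) y) (fun y _ => hasDerivAt_const y 0)
      (fun y hy => ?_) (fun y _ => hmaj0 _ _ (by norm_num) (by norm_num) y) (fun y _ => le_rfl) hNlim (hmajlim _ _)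
      tendsto_const_nhds
    have h := (hptI y hy le_rfl).2.2.2.2.1
    simpa using h
  set Nb := Real.exp (1122 / 100 * Real.exp (Real.log (1 / ‖Λ‖)) + 21 / 2 * Real.exp (Real.log (1 / ‖Λ‖)) ^ 2) * Einf with hNbdef
  have hNb : ∀ y ≤ (Real.log (1 / ‖Λ‖)), (fun t => ‖((Real.exp t : ℂ) * ŵ t)‖ ^ 2 / 9 + ‖((Real.exp t : ℂ) * ŝ t)‖ ^ 2) y ≤ Nb := by
    intro y hy
    refine (hN y hy).trans ?_
    simp only [add_zero]
    exact mul_le_mul_of_nonneg_right (Real.exp_le_exp.2 (hmajmono _ _ (by norm_num) (by norm_num) y _ hy)) hE0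
  have hNb0 : 0 ≤ Nb := by positivity
  -- (E) total energy on region I
  have hE : ∀ y ≤ (Real.log (1 / ‖Λ‖)), (fun t => ‖(((Real.exp t : ℂ) * ŝ t) + (Λ * ((-S t / ((W t - 1) ^ 2 - S t ^ 2) : ℝ) : ℂ) / 3) * ((Real.exp t : ℂ) * ŵ t))‖ ^ 2 + ‖(Λ * ((-S t / ((W t - 1) ^ 2 - S t ^ 2) : ℝ) : ℂ) * ((Real.exp t : ℂ) * ŝ t))‖ ^ 2) y ≤ Real.exp (1236 / 100 * Real.exp y + 445 / 20 * Real.exp y ^ 2) * (Einf + ((63 / 10 * Real.exp y + 115 / 20 * Real.exp y ^ 2) * Nb)) := by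
    refine barrier_upper_atBot (f' := deriv (fun t => ‖(((Real.exp t : ℂ) * ŝ t) + (Λ * ((-S t / ((W t - 1) ^ 2 - S t ^ 2) : ℝ) : ℂ) / 3) * ((Real.exp t : ℂ) * ŵ t))‖ ^ 2 + ‖(Λ * ((-S t / ((W t - 1) ^ 2 - S t ^ 2) : ℝ) : ℂ) * ((Real.exp t : ℂ) * ŝ t))‖ ^ 2)) (𝔞' := (fun y => (1236 / 100 * Real.exp y + 445 / 10 * Real.exp y ^ 2))) (𝔟' := (fun y => ((63 / 10 * Real.exp y + 115 / 10 * Real.exp y ^ 2) * Nb)))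
      (fun y hy => (hptI y hy (hNb y hy)).2.1.hasDerivAt) (fun y _ => hmaj _ _ _ (by norm_num) y)
      (fun y _ => (hmaj (63 / 10) (115 / 20) (115 / 10) (by norm_num) y).mul_const Nb)
      (fun y hy => (hptI y hy (hNb y hy)).2.2.2.2.2.1) (fun y _ => hmaj0 _ _ (by norm_num) (by norm_num) y)
      (fun y _ => mul_nonneg (hmaj0 _ _ (by norm_num) (by norm_num) y) hNb0) hElim (hmajlim _ _) ?_
    simpa using (hmajlim (63 / 10) (115 / 20)).mul_const Nb
  set Eb := Real.exp (1236 / 100 * Real.exp (Real.log (1 / ‖Λ‖)) + 445 / 20 * Real.exp (Real.log (1 / ‖Λ‖)) ^ 2) *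
    (Einf + (63 / 10 * Real.exp (Real.log (1 / ‖Λ‖)) + 115 / 20 * Real.exp (Real.log (1 / ‖Λ‖)) ^ 2) * Nb) with hEbdef
  have hEb : ∀ y ≤ (Real.log (1 / ‖Λ‖)), (fun t => ‖(((Real.exp t : ℂ) * ŝ t) + (Λ * ((-S t / ((W t - 1) ^ 2 - S t ^ 2) : ℝ) : ℂ) / 3) * ((Real.exp t : ℂ) * ŵ t))‖ ^ 2 + ‖(Λ * ((-S t / ((W t - 1) ^ 2 - S t ^ 2) : ℝ) : ℂ) * ((Real.exp t : ℂ) * ŝ t))‖ ^ 2) y ≤ Eb := by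
    intro y hy
    refine (hE y hy).trans ?_
    have h1 := hmajmono (1236 / 100) (445 / 20) (by norm_num) (by norm_num) y _ hy
    have h2 := hmajmono (63 / 10) (115 / 20) (by norm_num) (by norm_num) y _ hy
    have h3 : Einf + (63 / 10 * Real.exp y + 115 / 20 * Real.exp y ^ 2) * Nb ≤
        Einf + (63 / 10 * Real.exp (Real.log (1 / ‖Λ‖)) + 115 / 20 * Real.exp (Real.log (1 / ‖Λ‖)) ^ 2) * Nb := by
      nlinarith
    exact mul_le_mul (Real.exp_le_exp.2 h1) h3 (by positivity) (by positivity)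
  have hEb0 : 0 ≤ Eb := by positivity
  -- (E₋) the minus family from −∞
  have hM : ∀ y ≤ (Real.log (1 / ‖Λ‖)), (fun t => ‖(((Real.exp t : ℂ) * ŝ t) + (Λ * ((-S t / ((W t - 1) ^ 2 - S t ^ 2) : ℝ) : ℂ) / 3) * ((Real.exp t : ℂ) * ŵ t)) - (Λ * ((-S t / ((W t - 1) ^ 2 - S t ^ 2) : ℝ) : ℂ) * ((Real.exp t : ℂ) * ŝ t))‖ ^ 2) y ≤ Real.exp (702 / 100 * Real.exp y + 335 / 20 * Real.exp y ^ 2) * (Einf + (11 * Real.exp y ^ 2 * Eb + (63 / 10 * Real.exp y + 115 / 20 * Real.exp y ^ 2) * Nb)) := by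
    refine barrier_upper_atBot (f' := deriv (fun t => ‖(((Real.exp t : ℂ) * ŝ t) + (Λ * ((-S t / ((W t - 1) ^ 2 - S t ^ 2) : ℝ) : ℂ) / 3) * ((Real.exp t : ℂ) * ŵ t)) - (Λ * ((-S t / ((W t - 1) ^ 2 - S t ^ 2) : ℝ) : ℂ) * ((Real.exp t : ℂ) * ŝ t))‖ ^ 2)) (𝔞' := (fun y => (702 / 100 * Real.exp y + 335 / 10 * Real.exp y ^ 2))) (𝔟' := (fun y => (22 * Real.exp y ^ 2 * Eb + (63 / 10 * Real.exp y + 115 / 10 * Real.exp y ^ 2) * Nb)))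
      (fun y hy => (hptI y hy (hNb y hy)).2.2.1.hasDerivAt) (fun y _ => hmaj _ _ _ (by norm_num) y) (fun y _ => ?_)
      (fun y hy => ?_) (fun y _ => hmaj0 _ _ (by norm_num) (by norm_num) y) (fun y _ => by positivity) hEmlim (hmajlim _ _) ?_
    · have h := (((hexp2 y).const_mul 11).mul_const Eb).add
        ((hmaj (63 / 10) (115 / 20) (115 / 10) (by norm_num) y).mul_const Nb)
      refine h.congr_deriv ?_
      ring
    · have h := (hptI y hy (hNb y hy)).2.2.2.2.2.2.1
      have h2 : 22 * Real.exp y ^ 2 * (fun t => ‖(((Real.exp t : ℂ) * ŝ t) + (Λ * ((-S t / ((W t - 1) ^ 2 - S t ^ 2) : ℝ) : ℂ) / 3) * ((Real.exp t : ℂ) * ŵ t))‖ ^ 2 + ‖(Λ * ((-S t / ((W t - 1) ^ 2 - S t ^ 2) : ℝ) : ℂ) * ((Real.exp t : ℂ) * ŝ t))‖ ^ 2) y ≤ 22 * Real.exp y ^ 2 * Eb :=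
        mul_le_mul_of_nonneg_left (hEb y hy) (by positivity)
      linarith
    · have h := (((Real.tendsto_exp_atBot.pow 2).const_mul 11).mul_const Eb).add
        ((hmajlim (63 / 10) (115 / 20)).mul_const Nb)
      simpa using h
  -- (E₊) the plus family from −∞
  have hPl : ∀ y ≤ (Real.log (1 / ‖Λ‖)), Real.exp (-(702 / 100 * Real.exp y + 2342 / 200 * Real.exp y ^ 2)) * (Einf - Real.exp (702 / 100 * Real.exp (Real.log (1 / ‖Λ‖)) + 2342 / 200 * Real.exp (Real.log (1 / ‖Λ‖)) ^ 2) * (11 * Real.exp y ^ 2 * Eb + (63 / 10 * Real.exp y + 115 / 20 * Real.exp y ^ 2) * Nb)) ≤ (fun t => ‖(((Real.exp t : ℂ) * ŝ t) + (Λ * ((-S t / ((W t - 1) ^ 2 - S t ^ 2) : ℝ) : ℂ) / 3) * ((Real.exp t : ℂ) * ŵ t)) + (Λ * ((-S t / ((W t - 1) ^ 2 - S t ^ 2) : ℝ) : ℂ) * ((Real.exp t : ℂ) * ŝ t))‖ ^ 2) y := by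
    refine barrier_lower_atBot (f' := deriv (fun t => ‖(((Real.exp t : ℂ) * ŝ t) + (Λ * ((-S t / ((W t - 1) ^ 2 - S t ^ 2) : ℝ) : ℂ) / 3) * ((Real.exp t : ℂ) * ŵ t)) + (Λ * ((-S t / ((W t - 1) ^ 2 - S t ^ 2) : ℝ) : ℂ) * ((Real.exp t : ℂ) * ŝ t))‖ ^ 2)) (𝔞' := (fun y => (702 / 100 * Real.exp y + 2342 / 100 * Real.exp y ^ 2))) (𝔟' := (fun y => (22 * Real.exp y ^ 2 * Eb + (63 / 10 * Real.exp y + 115 / 10 * Real.exp y ^ 2) * Nb)))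
      (fun y hy => (hptI y hy (hNb y hy)).2.2.2.1.hasDerivAt) (fun y _ => hmaj _ _ _ (by norm_num) y) (fun y _ => ?_)
      (fun y hy => ?_) (fun y hy => hmajmono _ _ (by norm_num) (by norm_num) y _ hy) (fun y _ => by positivity) hEplim
      (hmajlim _ _) ?_
    · have h := (((hexp2 y).const_mul 11).mul_const Eb).add
        ((hmaj (63 / 10) (115 / 20) (115 / 10) (by norm_num) y).mul_const Nb)
      refine h.congr_deriv ?_
      ring
    · have h := (hptI y hy (hNb y hy)).2.2.2.2.2.2.2
      have h2 : 22 * Real.exp y ^ 2 * (fun t => ‖(((Real.exp t : ℂ) * ŝ t) + (Λ * ((-S t / ((W t - 1) ^ 2 - S t ^ 2) : ℝ) : ℂ) / 3) * ((Real.exp t : ℂ) * ŵ t))‖ ^ 2 + ‖(Λ * ((-S t / ((W t - 1) ^ 2 - S t ^ 2) : ℝ) : ℂ) * ((Real.exp t : ℂ) * ŝ t))‖ ^ 2) y ≤ 22 * Real.exp y ^ 2 * Eb :=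
        mul_le_mul_of_nonneg_left (hEb y hy) (by positivity)
      linarith
    · have h := (((Real.tendsto_exp_atBot.pow 2).const_mul 11).mul_const Eb).add
        ((hmajlim (63 / 10) (115 / 20)).mul_const Nb)
      simpa using h
  -- numerics at x₁ (ρ₁ = 1/‖Λ‖ ≤ 1/1000)
  obtain ⟨hEb1, hEm1, hEp1⟩ := regionI_numerics (Real.exp (Real.log (1 / ‖Λ‖))) Einf Nb Eb ((fun t => ‖(((Real.exp t : ℂ) * ŝ t) + (Λ * ((-S t / ((W t - 1) ^ 2 - S t ^ 2) : ℝ) : ℂ) / 3) * ((Real.exp t : ℂ) * ŵ t)) - (Λ * ((-S t / ((W t - 1) ^ 2 - S t ^ 2) : ℝ) : ℂ) * ((Real.exp t : ℂ) * ŝ t))‖ ^ 2) (Real.log (1 / ‖Λ‖))) ((fun t => ‖(((Real.exp t : ℂ) * ŝ t) + (Λ * ((-S t / ((W t - 1) ^ 2 - S t ^ 2) : ℝ) : ℂ) / 3) * ((Real.exp t : ℂ) * ŵ t)) + (Λ * ((-S t / ((W t - 1) ^ 2 - S t ^ 2) : ℝ) : ℂ) * ((Real.exp t : ℂ) * ŝ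 t))‖ ^ 2) (Real.log (1 / ‖Λ‖))) hρ₁0 hρ₁ hE0
    hNbdef hEbdef (hM _ le_rfl) (hPl _ le_rfl)
  exact ⟨Einf, hE0, (hEb _ le_rfl).trans hEb1, hEm1, hEp1⟩

end Summit.AtomisticToContinuum.HydrodynamicLimit.Theorems.SonicCavityRenewal

end
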